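import Summits.Ventures.CertifiedManyBodySolver.Downfold.EmeryZoneOrbitalContentCells
import HarnessLib

/-!
# THE ORBITAL PARTITION OF THE HOLES OVER THE ZONE, IV: the certificate, its sums, and the assembled bracket theorem

Venture CertifiedManyBodySolver, cell `pub/hubbard-downfold` (stage S1; INFLATION-RULES-3to1-B §B.81), seat hubbard-downfold-mod-4
(technique B, g33); namespace `Summit.Ventures.CertifiedManyBodySolver.Downfold.Emery`. Everything PROVED (0 sorry). WHAT THIS IS NOT: a
statement about any material; `U = 0` one-body kinematics of the σ model.

* `ZoneCert` — the data of one (set, Fermi-energy bracket) certificate: the printed quartet `(Δ, t_pd, t_pp, t_pp′) ∈ ℚ⁴`, the bracket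
  `[e₁, e₂]`, the shell width `h` and count `M` (levels `E_m = e₁ + m·h`), the fine staircases `jin1` (inner at `e₁`), `jout2` (outer
  at `e₂`) on `K = 384`, the coarse staircase codes `100·co + ci` per row of the `K = 64` grid and per level `m = 1 … M−1`, and six
  claimed integers;
* `zoneCheck` — parameters, levels, shells, fine / coarse staircases (the last level above the band everywhere) and the SUMS over fine
  rows × coarse columns (block counts `cnt`, weights from the per-coarse-cell table `wtab`), all decided by the kernel;
* **`zone_bounds_of_check`**: `zoneCheck C = true` ⇒ for every Fermi energy `ε_F ∈ [e₁, e₂]`: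
  `2·dLo/(384²·10⁵) ≤ n_d^h(ε_F) ≤ 2·dHi/(384²·10⁵)`, the same for `2n_p^h` with `pLo, pHi`, and `2·nLo/384² ≤ n^h ≤ 2·nHi/384²`.
  With `fermiEnergy_mem_Icc_of_pointBracketCheck` (the census bracket certificates `…_br`) this gives the hole partition AT A FILLING.

Sources: [HybertsenSchluterChristensen1989, Eq. (1)]; [AndersenEtAl1995, §6]; interval arithmetic [folklore] (Moore 1966).
-/

namespace Summit.Ventures.CertifiedManyBodySolver.Downfold.Emery

open Real Set MeasureTheory
open scoped ENNReal

/-! ## §6 The certificate and its checker -/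

/-- One zone-partition certificate (see the module docstring). [folklore] -/
structure ZoneCert where
  /-- `Δ_pd` -/
  Δ : ℚ
  /-- `t_pd` -/
  a : ℚ
  /-- `t_pp` -/
  b : ℚ
  /-- `t_pp′` -/
  c : ℚ
  /-- lower end of the Fermi-energy bracket -/
  e1 : ℚ
  /-- upper end of the Fermi-energy bracket -/
  e2 : ℚ
  /-- shell width -/
  h : ℚ
  /-- number of levels `E_0 … E_{M−1}` -/
  M : ℕ
  /-- fine inner staircase at `e₁` -/
  jin1 : List ℕ
  /-- fine outer staircase at `e₂` -/
  jout2 : List ℕ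
  /-- coarse codes: row `I ↦` list over `m = 1 … M−1` of `100·co + ci` -/
  coarse : List (List ℕ)
  /-- claimed `Σ cnt·wl` (d lower) -/
  dLo : ℤ
  /-- claimed d upper -/
  dHi : ℤ
  /-- claimed p lower -/
  pLo : ℤ
  /-- claimed p upper -/
  pHi : ℤ
  /-- claimed hole-count lower -/
  nLo : ℤ
  /-- claimed hole-count upper -/
  nHi : ℤ

namespace ZoneCert

variable (C : ZoneCert)

/-- Level energy `E_m = e₁ + m·h`. [folklore] -/
def E (m : ℕ) : ℚ := C.e1 + (m : ℚ) * C.h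

/-- Integer data of the levels `m = 1 … M−1`. [folklore] -/
def levels : List LevelZ := (List.range (C.M - 1)).map fun m' => levelZ C.Δ C.a C.b C.c (C.E (m' + 1))

/-- Integer data of the shells `m = 0 … M−2`. [folklore] -/
def shells : List ShellZ := (List.range (C.M - 1)).map fun m => shellZ C.Δ C.a C.b C.c (C.E m) C.h

/-- Parameter / shape checks. [folklore] -/
def paramOK : Bool :=
  decide (0 ≤ C.Δ) && decide (0 ≤ C.c) && decide (C.c ≤ C.b) && decide (0 < C.a) && decide (0 < C.h) && decide (0 < C.e1) &&
  decide (C.e1 ≤ C.e2) && decide (2 ≤ C.M) && decide (C.coarse.length = 64) && decide (C.jin1.length = 384) &&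
  decide (C.jout2.length = 384)

/-- All levels admissible. [folklore] -/
def levelsOK : Bool :=
  levelOK C.Δ C.a C.b C.c C.e1 && levelOK C.Δ C.a C.b C.c C.e2 &&
  (List.range (C.M - 1)).all fun m' => levelOK C.Δ C.a C.b C.c (C.E (m' + 1))

/-- All shells admissible. [folklore] -/
def shellsOK : Bool := (List.range (C.M - 1)).all fun m => shellOK C.Δ C.a C.b C.c (C.E m) C.h

/-- Fine staircases certified. [folklore] -/
def fineOK : Bool :=
  let lv1 := levelZ C.Δ C.a C.b C.c C.e1
  let lv2 := levelZ C.Δ C.a C.b C.c C.e2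
  (List.range 384).all fun i =>
    (decide (C.jin1.getD i 0 ≤ 384) && (decide (C.jin1.getD i 0 = 0) || innerZ lv1 (XH (i + 1)) (XH (C.jin1.getD i 0)))) &&
    (decide (C.jout2.getD i 0 ≤ 384) && (decide (C.jout2.getD i 0 = 384) || outerZ lv2 (XL i) (XL (C.jout2.getD i 0))))

/-- Coarse staircases certified (and the last level above the band for every row). [folklore] -/
def coarseOK : Bool :=
  let lvls := C.levels
  (List.range 64).all fun I =>
    let codes := C.coarse.getD I []
    decide (codes.length = C.M - 1) && decide ((codes.getD (C.M - 2) 0) % 100 = 64) &&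
    (List.range (C.M - 1)).all fun m' =>
      let lv := lvls.getD m' ⟨0, 0, 0, 0, 0, 0⟩
      let cd := codes.getD m' 0
      decide (cd / 100 ≤ 64) && decide (cd % 100 ≤ 64) &&
      (decide (cd / 100 = 64) || outerZ lv (XL6 I) (XL6 (cd / 100))) &&
      (decide (cd % 100 = 0) || innerZ lv (XH6 (I + 1)) (XH6 (cd % 100)))

/-- The per-coarse-cell LOWER weight table at scale `W`. [folklore] -/
def wtabLo : List (List ℤ) :=
  let shs := C.shells
  (List.range 64).map fun I =>
    let cos := (C.coarse.getD I []).map (· / 100)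
    let cis := (C.coarse.getD I []).map (· % 100)
    (List.range 64).map fun J => cellWlo shs (mloOf cos J) (mhiOf cis J) (sRangeZ I J).1

/-- The per-coarse-cell UPPER weight table at scale `W`. [folklore] -/
def wtabHi : List (List ℤ) :=
  let shs := C.shells
  (List.range 64).map fun I =>
    let cos := (C.coarse.getD I []).map (· / 100)
    let cis := (C.coarse.getD I []).map (· % 100)
    (List.range 64).map fun J => cellWhi shs (mloOf cos J) (mhiOf cis J) (sRangeZ I J).2

end ZoneCert

/-- Block count: the number of fine columns `j ∈ [6J, 6J + 6)` with `jo ≤ j` is `6 − (jo − 6J)` (truncated). [folklore] -/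
def cnt (jo J : ℕ) : ℕ := 6 - (jo - 6 * J)

/-- The six fine thresholds of coarse row `I`. [folklore] -/
def sixAt (thr : List ℕ) (I : ℕ) : List ℕ := (thr.drop (6 * I)).take 6

/-- Block count of a coarse cell from the six fine thresholds of its row: `Σ_u cnt (thr_u) J`. [folklore] -/
def cnt6 (six : List ℕ) (J : ℕ) : ℕ := (six.map fun jo => cnt jo J).sum

/-- `Σ_{J < 64}` as a list sum. [folklore] -/
def rowZ (f : ℕ → ℤ) : ℤ := ((List.range 64).map f).sum

/-- Guarded product (does not force the weight when the count is zero). [folklore] -/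
def gmul (n : ℕ) (w : ℤ) : ℤ := if n = 0 then 0 else (n : ℤ) * w

namespace ZoneCert

variable (C : ZoneCert)

/-- `Σ_I Σ_J cC(I, J)·wl(I, J)` with `cC` the certainly-hole block count (outer staircase at `e₂`). [folklore] -/
def dLoS (wt : List (List ℤ)) : ℤ :=
  rowZ fun I => let six := sixAt C.jout2 I; let row := wt.getD I []; rowZ fun J => gmul (cnt6 six J) (row.getD J 0)
/-- `Σ_I Σ_J cP(I, J)·(W − wl(I, J))` with `cP` the possibly-hole block count (inner staircase at `e₁`). [folklore] -/
def pHiS (wt : List (List ℤ)) : ℤ :=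
  rowZ fun I => let six := sixAt C.jin1 I; let row := wt.getD I []; rowZ fun J => gmul (cnt6 six J) (wW - row.getD J 0)
/-- `Σ_I Σ_J cP(I, J)·wh(I, J)`. [folklore] -/
def dHiS (wt : List (List ℤ)) : ℤ :=
  rowZ fun I => let six := sixAt C.jin1 I; let row := wt.getD I []; rowZ fun J => gmul (cnt6 six J) (row.getD J 0)
/-- `Σ_I Σ_J cC(I, J)·(W − wh(I, J))`. [folklore] -/
def pLoS (wt : List (List ℤ)) : ℤ :=
  rowZ fun I => let six := sixAt C.jout2 I; let row := wt.getD I []; rowZ fun J => gmul (cnt6 six J) (wW - row.getD J 0)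
/-- `Σ_I Σ_J cC(I, J)`. [folklore] -/
def nLoS : ℤ := rowZ fun I => let six := sixAt C.jout2 I; rowZ fun J => (cnt6 six J : ℤ)
/-- `Σ_I Σ_J cP(I, J)`. [folklore] -/
def nHiS : ℤ := rowZ fun I => let six := sixAt C.jin1 I; rowZ fun J => (cnt6 six J : ℤ)

/-- The claimed integers that use the LOWER table are implied by the computed sums. [folklore] -/
def sumsLoOK : Bool :=
  let wt := C.wtabLo
  decide (C.dLo ≤ C.dLoS wt) && decide (C.pHiS wt ≤ C.pHi) && decide (C.nLo ≤ C.nLoS) && decide (C.nHiS ≤ C.nHi)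

/-- The claimed integers that use the UPPER table are implied by the computed sums. [folklore] -/
def sumsHiOK : Bool :=
  let wt := C.wtabHi
  decide (C.dHiS wt ≤ C.dHi) && decide (C.pLo ≤ C.pLoS wt)

/-- **THE ZONE CHECKER** (in census files each conjunct is decided by the kernel separately). [folklore] -/
def zoneCheck : Bool := C.paramOK && C.levelsOK && C.fineOK && C.shellsOK && C.coarseOK && C.sumsLoOK && C.sumsHiOK

end ZoneCert

end Summit.Ventures.CertifiedManyBodySolver.Downfold.Emery
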